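import Summits.ValiantsHypothesis.ValiantsHypothesis.Theorems.BarrierLeverChowThinRowsScaleChoice

/-!
# Route BarrierLever — item `ChowHitsThinRowPartitionMinorsR` (stmt-ValiantsHypothesis-21850, budget
# `h·h`): choice of the scale in the presence of squared gadget `y`-parts

Helper file (`--supports stmt-ValiantsHypothesis-21850`; cell valiant-natproofs, rung V4, 𝒟-side;
seat val-np-p5 gen 28).  Closes NO item; definition-free; imports only val-np-p7 g4's
`…ChowThinRowsScaleChoice`.

`exists_good_scale_sq` is `ChowThinAll.exists_good_scale` with an extra `y`-only factor
`∏_{i ∈ T} (1 + s·Σ_{c ∈ D i} y_c)²` (the squared `y`-parts of the antipodal pair gadgets of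
`…ChowHitsThinRowPartitionMinorsRGadget`, all at scale `s`): if every singleton is in `PT` and
`det [U i ⊆ w j] ≠ 0`, then for some `s ≠ 0` the matrix
`B̃_s[i,j] = [U i ⊆ w j] · b_s(w j ∖ U i)`, `b_s(W') = coeff_{y^{W'}} (∏_{V ∈ PT} φ⁰_V(s) · ∏_{i∈T} Y_i(s)²)`,
is nonsingular (at `s = 0` the gadget parts are `1`, `b_0 ≡ 1`, `B̃_0 = [U i ⊆ w j]`; polynomial
dependence on `s` through the coefficient ring `ℂ[X]`).

WHAT THIS IS NOT: bookkeeping; nothing on items 21850 / 21882 / 19717 themselves, on crux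
stmt-ValiantsHypothesis-14610, or on `VP` versus `VNP`.
-/

set_option linter.dupNamespace false

namespace Summit.ValiantsHypothesis.ValiantsHypothesis.Theorems.BarrierLever.ChowThinHH

open Finset MvPolynomial
open Summit.ValiantsHypothesis.ValiantsHypothesis.Theorems.BarrierLever.ChowThinAll
  (coeff_empty_prod_singletonForms scaledCoeff_zero)

variable {h r : ℕ}

/-- **Choice of the scale with squared gadget parts.**  See the module docstring. -/
theorem exists_good_scale_sq (U w : Fin r → Finset (Fin h)) (PT : Finset (Finset (Fin h)))
    (hsing : ∀ c : Fin h, ({c} : Finset (Fin h)) ∈ PT) (T : Finset (Fin r)) (D : Fin r → Finset (Fin h))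
    (hZ : (Matrix.of fun i j : Fin r => if U i ⊆ w j then (1 : ℂ) else 0).det ≠ 0) :
    ∃ s : ℂ, s ≠ 0 ∧
      (Matrix.of fun i j : Fin r => if U i ⊆ w j then
        coeff (∑ a ∈ (∅ : Finset (Fin h)), Finsupp.single (Fin.castAdd h a) 1 +
            ∑ c ∈ w j \ U i, Finsupp.single (Fin.natAdd h c) 1)
          ((∏ V ∈ PT, (C 1 + ∑ a, C ((fun (_ : Fin h) (_ : Finset (Fin h)) => (0 : ℂ)) a V) *
              X (Fin.castAdd h a) +
            ∑ c, C ((if V.card ≤ 1 then (1 : ℂ) else s) * (if c ∈ V then 1 else 0)) * X (Fin.natAdd h c))) *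
           ∏ i' ∈ T, (C 1 + ∑ c, C (s * (if c ∈ D i' then 1 else 0)) * X (Fin.natAdd h c)) ^ 2)
        else 0).det ≠ 0 := by
  classical
  -- the product over the coefficient ring `ℂ[X]`
  set BX : MvPolynomial (Fin (h + h)) (Polynomial ℂ) :=
    (∏ V ∈ PT, (C 1 + ∑ a, C ((fun (_ : Fin h) (_ : Finset (Fin h)) => (0 : Polynomial ℂ)) a V) *
        X (Fin.castAdd h a) +
      ∑ c, C ((if V.card ≤ 1 then (1 : Polynomial ℂ) else Polynomial.X) *
        (if c ∈ V then 1 else 0)) * X (Fin.natAdd h c))) *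
      ∏ i' ∈ T, (C 1 + ∑ c, C (Polynomial.X * (if c ∈ D i' then 1 else 0)) * X (Fin.natAdd h c)) ^ 2
    with hBX
  set bX : Finset (Fin h) → Polynomial ℂ := fun W' =>
    coeff (∑ a ∈ (∅ : Finset (Fin h)), Finsupp.single (Fin.castAdd h a) 1 +
      ∑ c ∈ W', Finsupp.single (Fin.natAdd h c) 1) BX with hbX
  -- specialisation `X ↦ s`
  have hmap : ∀ s : ℂ, MvPolynomial.map (Polynomial.evalRingHom s) BX =
      (∏ V ∈ PT, (C 1 + ∑ a, C ((fun (_ : Fin h) (_ : Finset (Fin h)) => (0 : ℂ)) a V) *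
          X (Fin.castAdd h a) +
        ∑ c, C ((if V.card ≤ 1 then (1 : ℂ) else s) * (if c ∈ V then 1 else 0)) * X (Fin.natAdd h c))) *
      ∏ i' ∈ T, (C 1 + ∑ c, C (s * (if c ∈ D i' then 1 else 0)) * X (Fin.natAdd h c)) ^ 2 := by
    intro s
    rw [hBX, map_mul, map_prod, map_prod]
    congr 1
    · refine Finset.prod_congr rfl fun V _ => ?_
      simp only [map_add, map_sum, map_mul, MvPolynomial.map_C, MvPolynomial.map_X,
        Polynomial.coe_evalRingHom, Polynomial.eval_one, Polynomial.eval_zero,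
        apply_ite (Polynomial.eval s), Polynomial.eval_X]
    · refine Finset.prod_congr rfl fun i' _ => ?_
      simp only [map_pow, map_add, map_sum, map_mul, MvPolynomial.map_C, MvPolynomial.map_X,
        Polynomial.coe_evalRingHom, Polynomial.eval_one, Polynomial.eval_zero,
        apply_ite (Polynomial.eval s), Polynomial.eval_X]
  have hb : ∀ (s : ℂ) (W' : Finset (Fin h)),
      coeff (∑ a ∈ (∅ : Finset (Fin h)), Finsupp.single (Fin.castAdd h a) 1 +
          ∑ c ∈ W', Finsupp.single (Fin.natAdd h c) 1)
        ((∏ V ∈ PT, (C 1 + ∑ a, C ((fun (_ : Fin h) (_ : Finset (Fin h)) => (0 : ℂ)) a V) *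
            X (Fin.castAdd h a) +
          ∑ c, C ((if V.card ≤ 1 then (1 : ℂ) else s) * (if c ∈ V then 1 else 0)) * X (Fin.natAdd h c))) *
         ∏ i' ∈ T, (C 1 + ∑ c, C (s * (if c ∈ D i' then 1 else 0)) * X (Fin.natAdd h c)) ^ 2) =
        Polynomial.eval s (bX W') := by
    intro s W'
    rw [← hmap s, MvPolynomial.coeff_map]
    rfl
  -- the matrix over `ℂ[X]`
  set MX : Matrix (Fin r) (Fin r) (Polynomial ℂ) :=
    Matrix.of fun i j => if U i ⊆ w j then bX (w j \ U i) else 0 with hMX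
  have hdet : ∀ s : ℂ, (Matrix.of fun i j : Fin r => if U i ⊆ w j then
        coeff (∑ a ∈ (∅ : Finset (Fin h)), Finsupp.single (Fin.castAdd h a) 1 +
            ∑ c ∈ w j \ U i, Finsupp.single (Fin.natAdd h c) 1)
          ((∏ V ∈ PT, (C 1 + ∑ a, C ((fun (_ : Fin h) (_ : Finset (Fin h)) => (0 : ℂ)) a V) *
              X (Fin.castAdd h a) +
            ∑ c, C ((if V.card ≤ 1 then (1 : ℂ) else s) * (if c ∈ V then 1 else 0)) * X (Fin.natAdd h c))) *
           ∏ i' ∈ T, (C 1 + ∑ c, C (s * (if c ∈ D i' then 1 else 0)) * X (Fin.natAdd h c)) ^ 2)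
        else 0).det = Polynomial.eval s MX.det := by
    intro s
    have e : (Matrix.of fun i j : Fin r => if U i ⊆ w j then
        coeff (∑ a ∈ (∅ : Finset (Fin h)), Finsupp.single (Fin.castAdd h a) 1 +
            ∑ c ∈ w j \ U i, Finsupp.single (Fin.natAdd h c) 1)
          ((∏ V ∈ PT, (C 1 + ∑ a, C ((fun (_ : Fin h) (_ : Finset (Fin h)) => (0 : ℂ)) a V) *
              X (Fin.castAdd h a) +
            ∑ c, C ((if V.card ≤ 1 then (1 : ℂ) else s) * (if c ∈ V then 1 else 0)) * X (Fin.natAdd h c))) *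
           ∏ i' ∈ T, (C 1 + ∑ c, C (s * (if c ∈ D i' then 1 else 0)) * X (Fin.natAdd h c)) ^ 2)
        else 0) = (Polynomial.evalRingHom s).mapMatrix MX := by
      ext i j
      rw [RingHom.mapMatrix_apply, Matrix.map_apply, hMX, Matrix.of_apply, Matrix.of_apply]
      by_cases hij : U i ⊆ w j
      · rw [if_pos hij, if_pos hij, hb]
        rfl
      · rw [if_neg hij, if_neg hij, map_zero]
    rw [e, ← RingHom.map_det]
    rfl
  -- at `s = 0`: the gadget parts are `1`, `b_0 ≡ 1`, `B̃_0 = Z`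
  have hgad0 : ∀ i' : Fin r, (C 1 + ∑ c, C ((0 : ℂ) * (if c ∈ D i' then 1 else 0)) * X (Fin.natAdd h c) :
      MvPolynomial (Fin (h + h)) ℂ) = 1 := by
    intro i'
    simp
  have hgad0' : ∏ i' ∈ T, (C 1 + ∑ c, C ((0 : ℂ) * (if c ∈ D i' then 1 else 0)) * X (Fin.natAdd h c) :
      MvPolynomial (Fin (h + h)) ℂ) ^ 2 = 1 :=
    Finset.prod_eq_one fun i' _ => by rw [hgad0 i', one_pow]
  have hb0 : ∀ W' : Finset (Fin h), Polynomial.eval 0 (bX W') = 1 := by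
    intro W'
    rw [← hb 0 W', hgad0', mul_one,
      coeff_empty_prod_singletonForms (fun V c => (if V.card ≤ 1 then (1 : ℂ) else 0) *
        (if c ∈ V then 1 else 0)) PT (fun V _ c => scaledCoeff_zero V c) W', if_pos (fun c _ => hsing c)]
  have hdet0 : Polynomial.eval 0 MX.det ≠ 0 := by
    rw [← hdet 0]
    have e : (Matrix.of fun i j : Fin r => if U i ⊆ w j then
        coeff (∑ a ∈ (∅ : Finset (Fin h)), Finsupp.single (Fin.castAdd h a) 1 +
            ∑ c ∈ w j \ U i, Finsupp.single (Fin.natAdd h c) 1)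
          ((∏ V ∈ PT, (C 1 + ∑ a, C ((fun (_ : Fin h) (_ : Finset (Fin h)) => (0 : ℂ)) a V) *
              X (Fin.castAdd h a) +
            ∑ c, C ((if V.card ≤ 1 then (1 : ℂ) else (0 : ℂ)) * (if c ∈ V then 1 else 0)) *
              X (Fin.natAdd h c))) *
           ∏ i' ∈ T, (C 1 + ∑ c, C ((0 : ℂ) * (if c ∈ D i' then 1 else 0)) * X (Fin.natAdd h c)) ^ 2)
        else 0) = Matrix.of fun i j : Fin r => if U i ⊆ w j then (1 : ℂ) else 0 := by
      ext i j
      rw [Matrix.of_apply, Matrix.of_apply]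
      by_cases hij : U i ⊆ w j
      · rw [if_pos hij, if_pos hij, hb 0, hb0]
      · rw [if_neg hij, if_neg hij]
    rw [e]
    exact hZ
  have hMX0 : MX.det ≠ 0 := fun e => hdet0 (by rw [e, Polynomial.eval_zero])
  -- a non-root of `X · det MX`
  set p : Polynomial ℂ := Polynomial.X * MX.det with hp
  have hp0 : p ≠ 0 := mul_ne_zero Polynomial.X_ne_zero hMX0
  obtain ⟨s, hs⟩ := Infinite.exists_notMem_finset p.roots.toFinset
  have hps : Polynomial.eval s p ≠ 0 := by
    intro e
    exact hs (Multiset.mem_toFinset.mpr ((Polynomial.mem_roots hp0).mpr e))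
  rw [hp, Polynomial.eval_mul, Polynomial.eval_X] at hps
  refine ⟨s, ?_, ?_⟩
  · exact fun e => hps (by rw [e, zero_mul])
  · rw [hdet s]
    exact fun e => hps (by rw [e, mul_zero])

/-- **Choice of the scale, singletons only for the USED coordinates.**  As `exists_good_scale_sq`, but
`PT` need only contain the singletons `{c}` of the coordinates `c` occurring in some column `w j`
(coordinates used by no column need no form). -/
theorem exists_good_scale_sq_used (U w : Fin r → Finset (Fin h)) (PT : Finset (Finset (Fin h)))
    (hsing : ∀ j, ∀ c ∈ w j, ({c} : Finset (Fin h)) ∈ PT) (T : Finset (Fin r)) (D : Fin r → Finset (Fin h))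
    (hZ : (Matrix.of fun i j : Fin r => if U i ⊆ w j then (1 : ℂ) else 0).det ≠ 0) :
    ∃ s : ℂ, s ≠ 0 ∧
      (Matrix.of fun i j : Fin r => if U i ⊆ w j then
        coeff (∑ a ∈ (∅ : Finset (Fin h)), Finsupp.single (Fin.castAdd h a) 1 +
            ∑ c ∈ w j \ U i, Finsupp.single (Fin.natAdd h c) 1)
          ((∏ V ∈ PT, (C 1 + ∑ a, C ((fun (_ : Fin h) (_ : Finset (Fin h)) => (0 : ℂ)) a V) *
              X (Fin.castAdd h a) +
            ∑ c, C ((if V.card ≤ 1 then (1 : ℂ) else s) * (if c ∈ V then 1 else 0)) * X (Fin.natAdd h c))) *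
           ∏ i' ∈ T, (C 1 + ∑ c, C (s * (if c ∈ D i' then 1 else 0)) * X (Fin.natAdd h c)) ^ 2)
        else 0).det ≠ 0 := by
  classical
  -- the product over the coefficient ring `ℂ[X]`
  set BX : MvPolynomial (Fin (h + h)) (Polynomial ℂ) :=
    (∏ V ∈ PT, (C 1 + ∑ a, C ((fun (_ : Fin h) (_ : Finset (Fin h)) => (0 : Polynomial ℂ)) a V) *
        X (Fin.castAdd h a) +
      ∑ c, C ((if V.card ≤ 1 then (1 : Polynomial ℂ) else Polynomial.X) *
        (if c ∈ V then 1 else 0)) * X (Fin.natAdd h c))) *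
      ∏ i' ∈ T, (C 1 + ∑ c, C (Polynomial.X * (if c ∈ D i' then 1 else 0)) * X (Fin.natAdd h c)) ^ 2
    with hBX
  set bX : Finset (Fin h) → Polynomial ℂ := fun W' =>
    coeff (∑ a ∈ (∅ : Finset (Fin h)), Finsupp.single (Fin.castAdd h a) 1 +
      ∑ c ∈ W', Finsupp.single (Fin.natAdd h c) 1) BX with hbX
  -- specialisation `X ↦ s`
  have hmap : ∀ s : ℂ, MvPolynomial.map (Polynomial.evalRingHom s) BX =
      (∏ V ∈ PT, (C 1 + ∑ a, C ((fun (_ : Fin h) (_ : Finset (Fin h)) => (0 : ℂ)) a V) *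
          X (Fin.castAdd h a) +
        ∑ c, C ((if V.card ≤ 1 then (1 : ℂ) else s) * (if c ∈ V then 1 else 0)) * X (Fin.natAdd h c))) *
      ∏ i' ∈ T, (C 1 + ∑ c, C (s * (if c ∈ D i' then 1 else 0)) * X (Fin.natAdd h c)) ^ 2 := by
    intro s
    rw [hBX, map_mul, map_prod, map_prod]
    congr 1
    · refine Finset.prod_congr rfl fun V _ => ?_
      simp only [map_add, map_sum, map_mul, MvPolynomial.map_C, MvPolynomial.map_X,
        Polynomial.coe_evalRingHom, Polynomial.eval_one, Polynomial.eval_zero,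
        apply_ite (Polynomial.eval s), Polynomial.eval_X]
    · refine Finset.prod_congr rfl fun i' _ => ?_
      simp only [map_pow, map_add, map_sum, map_mul, MvPolynomial.map_C, MvPolynomial.map_X,
        Polynomial.coe_evalRingHom, Polynomial.eval_one, Polynomial.eval_zero,
        apply_ite (Polynomial.eval s), Polynomial.eval_X]
  have hb : ∀ (s : ℂ) (W' : Finset (Fin h)),
      coeff (∑ a ∈ (∅ : Finset (Fin h)), Finsupp.single (Fin.castAdd h a) 1 +
          ∑ c ∈ W', Finsupp.single (Fin.natAdd h c) 1)
        ((∏ V ∈ PT, (C 1 + ∑ a, C ((fun (_ : Fin h) (_ : Finset (Fin h)) => (0 : ℂ)) a V) *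
            X (Fin.castAdd h a) +
          ∑ c, C ((if V.card ≤ 1 then (1 : ℂ) else s) * (if c ∈ V then 1 else 0)) * X (Fin.natAdd h c))) *
         ∏ i' ∈ T, (C 1 + ∑ c, C (s * (if c ∈ D i' then 1 else 0)) * X (Fin.natAdd h c)) ^ 2) =
        Polynomial.eval s (bX W') := by
    intro s W'
    rw [← hmap s, MvPolynomial.coeff_map]
    rfl
  -- the matrix over `ℂ[X]`
  set MX : Matrix (Fin r) (Fin r) (Polynomial ℂ) :=
    Matrix.of fun i j => if U i ⊆ w j then bX (w j \ U i) else 0 with hMX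
  have hdet : ∀ s : ℂ, (Matrix.of fun i j : Fin r => if U i ⊆ w j then
        coeff (∑ a ∈ (∅ : Finset (Fin h)), Finsupp.single (Fin.castAdd h a) 1 +
            ∑ c ∈ w j \ U i, Finsupp.single (Fin.natAdd h c) 1)
          ((∏ V ∈ PT, (C 1 + ∑ a, C ((fun (_ : Fin h) (_ : Finset (Fin h)) => (0 : ℂ)) a V) *
              X (Fin.castAdd h a) +
            ∑ c, C ((if V.card ≤ 1 then (1 : ℂ) else s) * (if c ∈ V then 1 else 0)) * X (Fin.natAdd h c))) *
           ∏ i' ∈ T, (C 1 + ∑ c, C (s * (if c ∈ D i' then 1 else 0)) * X (Fin.natAdd h c)) ^ 2)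
        else 0).det = Polynomial.eval s MX.det := by
    intro s
    have e : (Matrix.of fun i j : Fin r => if U i ⊆ w j then
        coeff (∑ a ∈ (∅ : Finset (Fin h)), Finsupp.single (Fin.castAdd h a) 1 +
            ∑ c ∈ w j \ U i, Finsupp.single (Fin.natAdd h c) 1)
          ((∏ V ∈ PT, (C 1 + ∑ a, C ((fun (_ : Fin h) (_ : Finset (Fin h)) => (0 : ℂ)) a V) *
              X (Fin.castAdd h a) +
            ∑ c, C ((if V.card ≤ 1 then (1 : ℂ) else s) * (if c ∈ V then 1 else 0)) * X (Fin.natAdd h c))) *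
           ∏ i' ∈ T, (C 1 + ∑ c, C (s * (if c ∈ D i' then 1 else 0)) * X (Fin.natAdd h c)) ^ 2)
        else 0) = (Polynomial.evalRingHom s).mapMatrix MX := by
      ext i j
      rw [RingHom.mapMatrix_apply, Matrix.map_apply, hMX, Matrix.of_apply, Matrix.of_apply]
      by_cases hij : U i ⊆ w j
      · rw [if_pos hij, if_pos hij, hb]
        rfl
      · rw [if_neg hij, if_neg hij, map_zero]
    rw [e, ← RingHom.map_det]
    rfl
  -- at `s = 0`: the gadget parts are `1`, `b_0 ≡ 1`, `B̃_0 = Z`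
  have hgad0 : ∀ i' : Fin r, (C 1 + ∑ c, C ((0 : ℂ) * (if c ∈ D i' then 1 else 0)) * X (Fin.natAdd h c) :
      MvPolynomial (Fin (h + h)) ℂ) = 1 := by
    intro i'
    simp
  have hgad0' : ∏ i' ∈ T, (C 1 + ∑ c, C ((0 : ℂ) * (if c ∈ D i' then 1 else 0)) * X (Fin.natAdd h c) :
      MvPolynomial (Fin (h + h)) ℂ) ^ 2 = 1 :=
    Finset.prod_eq_one fun i' _ => by rw [hgad0 i', one_pow]
  have hb0 : ∀ (j : Fin r) (W' : Finset (Fin h)), W' ⊆ w j → Polynomial.eval 0 (bX W') = 1 := by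
    intro j W' hW'
    rw [← hb 0 W', hgad0', mul_one,
      coeff_empty_prod_singletonForms (fun V c => (if V.card ≤ 1 then (1 : ℂ) else 0) *
        (if c ∈ V then 1 else 0)) PT (fun V _ c => scaledCoeff_zero V c) W',
      if_pos (fun c hc => hsing j c (hW' hc))]
  have hdet0 : Polynomial.eval 0 MX.det ≠ 0 := by
    rw [← hdet 0]
    have e : (Matrix.of fun i j : Fin r => if U i ⊆ w j then
        coeff (∑ a ∈ (∅ : Finset (Fin h)), Finsupp.single (Fin.castAdd h a) 1 +
            ∑ c ∈ w j \ U i, Finsupp.single (Fin.natAdd h c) 1)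
          ((∏ V ∈ PT, (C 1 + ∑ a, C ((fun (_ : Fin h) (_ : Finset (Fin h)) => (0 : ℂ)) a V) *
              X (Fin.castAdd h a) +
            ∑ c, C ((if V.card ≤ 1 then (1 : ℂ) else (0 : ℂ)) * (if c ∈ V then 1 else 0)) *
              X (Fin.natAdd h c))) *
           ∏ i' ∈ T, (C 1 + ∑ c, C ((0 : ℂ) * (if c ∈ D i' then 1 else 0)) * X (Fin.natAdd h c)) ^ 2)
        else 0) = Matrix.of fun i j : Fin r => if U i ⊆ w j then (1 : ℂ) else 0 := by
      ext i j
      rw [Matrix.of_apply, Matrix.of_apply]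
      by_cases hij : U i ⊆ w j
      · rw [if_pos hij, if_pos hij, hb 0, hb0 j _ Finset.sdiff_subset]
      · rw [if_neg hij, if_neg hij]
    rw [e]
    exact hZ
  have hMX0 : MX.det ≠ 0 := fun e => hdet0 (by rw [e, Polynomial.eval_zero])
  -- a non-root of `X · det MX`
  set p : Polynomial ℂ := Polynomial.X * MX.det with hp
  have hp0 : p ≠ 0 := mul_ne_zero Polynomial.X_ne_zero hMX0
  obtain ⟨s, hs⟩ := Infinite.exists_notMem_finset p.roots.toFinset
  have hps : Polynomial.eval s p ≠ 0 := by
    intro e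
    exact hs (Multiset.mem_toFinset.mpr ((Polynomial.mem_roots hp0).mpr e))
  rw [hp, Polynomial.eval_mul, Polynomial.eval_X] at hps
  refine ⟨s, ?_, ?_⟩
  · exact fun e => hps (by rw [e, zero_mul])
  · rw [hdet s]
    exact fun e => hps (by rw [e, mul_zero])

end Summit.ValiantsHypothesis.ValiantsHypothesis.Theorems.BarrierLever.ChowThinHH
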